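import Mathlib.Tactic
import HarnessLib

/-!
# Kozma–Nitzan's Question 8 at three relays — the (T*) ⟸ CLAIM(M) reduction, scalar skeleton

Support file (`--supports stmt-CriticalPhenomena-4575`, closed crux; independent mathematics on Kozma–Nitzan's Question 8,
arXiv:2401.12397 §5.5 p. 36), prover `prim-ineq-gen-7` (gen 12).  No definitions, no named facts, no sorries; standard axioms.
Memo `run/shared/lean/prim/prim-ineq-gen-7/FINDING-TSTAR-g12.md` §4.

In the frame `ν' = μ(· | {x,o} ↮ Y)` of the five-point inequality (PS5) the configuration space splits into the five atoms
`OV = {x~o~v}`, `OM = {x~o, x≁v}`, `E = {o~v, x≁o}`, `PV = {x~v, o≁x, o≁v}`, `PM = {x, o, v pairwise separated}`; write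
`mA` for the mass of atom `A` and `gA = ∫_A Ĝ` for an increasing function `Ĝ` of the edge cluster of `{x,o}`.  The remaining
inequality of the cell, (T*) (both halves of (**) = the covariance side and the centring side (UPZ) of KN Q8@3), is
  `star := mPM·((mPV+mPM)(gOV+gOM) − (mOV+mOM)(gPV+gPM)) − mE·(mPM(gPV+gPM) − (mPV+mPM) gPM) ≥ 0`.
* `PocketCert.tstar_of_claimM_abstract` — **(T*) from CLAIM(M) and the proved rows**, as an inequality between real numbers:
  hypotheses (α) `law(O2) ≽ law(P)`, (D2) `law(OM) ≽ law(PM)`, (c4′) `mO2·mPV ≤ mP·mOV` (all three are tree theorems: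
  `PocketCert.frameDom_o2_p`, `frameDom_om_pm`, `frameCov_ov_o2` with `G = 1`) and CLAIM(M) in the form `c*(Ĝ) ≥ E'[Ĝ | M]`, i.e.
  `gM·(mP·mOV − mO2·mPV) ≤ mM·(mP·gOV − mO2·gPV)`; conclusion `star ≥ 0`.  Proof = the dichotomy of the memo: if
  `gE·mPM ≤ gPM·mE` (K2b holds for `Ĝ`) then `star = mPM·X_α + mP·(mE gPM − mPM gE)`; otherwise CLAIM(M) and (D2) give the
  splitting inequality `mP mPM gOV ≥ mO2 mPM gPV + (mOV mP − mO2 mPV) gPM` and `star = SPLIT + mP·(mPM gOM − mOM gPM)`.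
So KN Question 8 at `|A| = 3` is reduced, in the tree, to instances of the single covariance-ratio inequality CLAIM(M)
(`ν'(M)·Cov'(Ĝ, 1{x~o~v}) ≥ ν'(o~{x,v}, x≁v)·Cov'(Ĝ, 1{x~v})`, memo §4) plus bookkeeping.
[cite: KozmaNitzan2024, Question 8 (§5.5 p. 36)] [cite: VandenbergHaggstromKahn2005, Thm. 2.1 (p. 9)]
-/

namespace Summit.CriticalPhenomena.PercolationContinuityZ3.Theorems

namespace PocketCert

/-- **(T*) ⟸ CLAIM(M) ∧ (α) ∧ (D2) ∧ (c4′)**, scalar form (see the module docstring for the dictionary).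
[cite: KozmaNitzan2024, Question 8 (§5.5 p. 36)] -/
theorem tstar_of_claimM_abstract (mOV mOM mE mPV mPM gOV gOM gE gPV gPM : ℝ)
    (hOM : 0 ≤ mOM) (hE : 0 ≤ mE) (hPV : 0 ≤ mPV) (hPM : 0 ≤ mPM)
    (hα : (mOV + mOM + mE) * (gPV + gPM) ≤ (mPV + mPM) * (gOV + gOM + gE))
    (hD2 : gPM * mOM ≤ gOM * mPM)
    (hc4 : (mOV + mOM + mE) * mPV ≤ (mPV + mPM) * mOV)
    (hM : (gOM + gE + gPM) * ((mPV + mPM) * mOV - (mOV + mOM + mE) * mPV) ≤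
      (mOM + mE + mPM) * ((mPV + mPM) * gOV - (mOV + mOM + mE) * gPV)) :
    0 ≤ mPM * ((mPV + mPM) * (gOV + gOM) - (mOV + mOM) * (gPV + gPM)) - mE * (mPM * (gPV + gPM) - (mPV + mPM) * gPM) := by
  set P := mPV + mPM with hP
  set O2 := mOV + mOM + mE with hO2
  have hP0 : 0 ≤ P := by rw [hP]; linarith
  -- (α) slack
  set Xα := P * (gOV + gOM + gE) - O2 * (gPV + gPM) with hXα
  have hXα0 : 0 ≤ Xα := by rw [hXα]; linarith
  -- identity 1:  star = mPM·Xα + P·(mE gPM − mPM gE)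
  have id1 : mPM * (P * (gOV + gOM) - (mOV + mOM) * (gPV + gPM)) - mE * (mPM * (gPV + gPM) - P * gPM) =
      mPM * Xα + P * (mE * gPM - mPM * gE) := by
    rw [hXα, hO2]; ring
  by_cases hK : gE * mPM ≤ gPM * mE
  · -- K2b holds for `Ĝ`: the PC0 argument
    rw [id1]
    have h1 : 0 ≤ mPM * Xα := mul_nonneg hPM hXα0
    have h2 : 0 ≤ P * (mE * gPM - mPM * gE) := mul_nonneg hP0 (by linarith)
    linarith
  · -- K2b fails: CLAIM(M) ⇒ SPLIT ⇒ (T*)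
    rw [not_le] at hK
    set slack := P * mOV - O2 * mPV with hslack
    have hslack0 : 0 ≤ slack := by rw [hslack]; linarith
    set M := mOM + mE + mPM with hMdef
    have hM0 : 0 ≤ M := by rw [hMdef]; linarith
    set SPLIT := P * mPM * gOV - O2 * mPM * gPV - (mOV * P - O2 * mPV) * gPM with hSPLIT
    -- identity 2: star = SPLIT + P·(mPM gOM − mOM gPM)
    have id2 : mPM * (P * (gOV + gOM) - (mOV + mOM) * (gPV + gPM)) - mE * (mPM * (gPV + gPM) - P * gPM) =
        SPLIT + P * (mPM * gOM - mOM * gPM) := by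
      rw [hSPLIT, hO2, hP]; ring
    -- identity 3: M·SPLIT = mPM·(M(P gOV − O2 gPV) − gM·slack) + slack·((gOM mPM − mOM gPM) + (gE mPM − mE gPM))
    have id3 : M * SPLIT = mPM * (M * (P * gOV - O2 * gPV) - (gOM + gE + gPM) * slack) +
        slack * ((gOM * mPM - mOM * gPM) + (gE * mPM - mE * gPM)) := by
      rw [hSPLIT, hslack, hMdef]; ring
    have hM' : (gOM + gE + gPM) * slack ≤ M * (P * gOV - O2 * gPV) := by
      rw [hslack, hMdef, hP, hO2]; exact hM
    have hMS : 0 ≤ M * SPLIT := by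
      rw [id3]
      have t1 : 0 ≤ mPM * (M * (P * gOV - O2 * gPV) - (gOM + gE + gPM) * slack) := mul_nonneg hPM (by linarith)
      have t2 : 0 ≤ slack * ((gOM * mPM - mOM * gPM) + (gE * mPM - mE * gPM)) :=
        mul_nonneg hslack0 (by nlinarith)
      linarith
    have hD2' : 0 ≤ P * (mPM * gOM - mOM * gPM) := mul_nonneg hP0 (by linarith)
    rcases eq_or_lt_of_le hM0 with hM00 | hMpos
    · -- M = 0: then mOM = mE = mPM = 0 and the left-hand side vanishes
      have hE0 : mE = 0 := by linarith
      have hPM0 : mPM = 0 := by linarith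
      have h0 : mPM * (P * (gOV + gOM) - (mOV + mOM) * (gPV + gPM)) - mE * (mPM * (gPV + gPM) - P * gPM) = 0 := by
        rw [hE0, hPM0]; ring
      rw [h0]
    · rw [id2]
      have hS : 0 ≤ SPLIT := by
        by_contra hneg
        rw [not_le] at hneg
        have : M * SPLIT < 0 := mul_neg_of_pos_of_neg hMpos hneg
        linarith
      linarith

/-- **(T*) ⟸ [K2b ∨ SPLIT] ∧ (α) ∧ (D2)**, scalar form — the CORRECTED atom (prim-ineq-gen-7 gen 12, exhaustive census 19:40Z: the
CLAIM(M) hypothesis of `tstar_of_claimM_abstract` fails in 12 / 6.4·10⁶ exhaustive instances, all in the regime where K2b holds, where it is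
not needed; what the dichotomy really consumes is the splitting inequality
`(SPLIT)  (mOV·mP − mO2·mPV)·gPM ≤ mP·mPM·gOV − mO2·mPM·gPV` ONLY in the regime `gPM·mE < gE·mPM` (K2b fails for `Ĝ`) — exhaustive n ≤ 5:
0 / 1.65·10⁶ in that regime; equivalently `c*(Ĝ) ≥ min(E'[Ĝ|E], E'[Ĝ|PM])`, 0 / 4.97·10⁶).  No mass inequality is needed.
[cite: KozmaNitzan2024, Question 8 (§5.5 p. 36)] -/
theorem tstar_of_split_abstract (mOV mOM mE mPV mPM gOV gOM gE gPV gPM : ℝ)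
    (hPV : 0 ≤ mPV) (hPM : 0 ≤ mPM)
    (hα : (mOV + mOM + mE) * (gPV + gPM) ≤ (mPV + mPM) * (gOV + gOM + gE))
    (hD2 : gPM * mOM ≤ gOM * mPM)
    (hS : gPM * mE < gE * mPM →
      (mOV * (mPV + mPM) - (mOV + mOM + mE) * mPV) * gPM ≤ (mPV + mPM) * mPM * gOV - (mOV + mOM + mE) * mPM * gPV) :
    0 ≤ mPM * ((mPV + mPM) * (gOV + gOM) - (mOV + mOM) * (gPV + gPM)) - mE * (mPM * (gPV + gPM) - (mPV + mPM) * gPM) := by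
  set P := mPV + mPM with hP
  set O2 := mOV + mOM + mE with hO2
  have hP0 : 0 ≤ P := by rw [hP]; linarith
  set Xα := P * (gOV + gOM + gE) - O2 * (gPV + gPM) with hXα
  have hXα0 : 0 ≤ Xα := by rw [hXα]; linarith
  have id1 : mPM * (P * (gOV + gOM) - (mOV + mOM) * (gPV + gPM)) - mE * (mPM * (gPV + gPM) - P * gPM) =
      mPM * Xα + P * (mE * gPM - mPM * gE) := by
    rw [hXα, hO2]; ring
  by_cases hK : gE * mPM ≤ gPM * mE
  · rw [id1]
    have h1 : 0 ≤ mPM * Xα := mul_nonneg hPM hXα0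
    have h2 : 0 ≤ P * (mE * gPM - mPM * gE) := mul_nonneg hP0 (by linarith)
    linarith
  · rw [not_le] at hK
    have hSPLIT := hS (by linarith)
    have id2 : mPM * (P * (gOV + gOM) - (mOV + mOM) * (gPV + gPM)) - mE * (mPM * (gPV + gPM) - P * gPM) =
        (P * mPM * gOV - O2 * mPM * gPV - (mOV * P - O2 * mPV) * gPM) + P * (mPM * gOM - mOM * gPM) := by
      rw [hO2, hP]; ring
    rw [id2]
    have hD2' : 0 ≤ P * (mPM * gOM - mOM * gPM) := mul_nonneg hP0 (by linarith)
    have hS' : 0 ≤ P * mPM * gOV - O2 * mPM * gPV - (mOV * P - O2 * mPV) * gPM := by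
      rw [hP, hO2]; linarith
    linarith

/-- **(T*)vc ⟸ [K2bvc ∨ SPLITvc′] ∧ (α) ∧ (D2)**, scalar form — the variant with the constant `e/π_Mvc` that the tree's peel/mediant chain
(`block41_three_of_ps5_internal`) consumes (`mPMvc` = mass of `PM ∩ {v ↮ Y}`, `0 ≤ mPMvc ≤ mPM`).  Here
`starvc := mP·(mPMvc·(gOV+gOM) − mE·gPV) − (mO·mPMvc − mE·mPV)·(gPV+gPM)`;  route (I): `starvc = mPMvc·X_α + K2bvc` with
`K2bvc := mE(mPMvc+mPV)(gPV+gPM) − mP·mPMvc·gE − mP·mE·gPV`; route (II): `mPM·starvc = SPLITvc + mP·mPMvc·(mPM gOM − mOM gPM)` with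
`SPLITvc := mP·mPM·mPMvc·gOV − (mO·mPMvc + mE·mPM)·mPM·gPV − (mOV·mP·mPMvc − (mO·mPMvc + mE·mPM)·mPV)·gPM` (census of the disjunction
K2bvc ∨ SPLITvc: exhaustive n ≤ 5, 0 / 4.97·10⁶; memo §8). [cite: KozmaNitzan2024, Question 8 (§5.5 p. 36)] -/
theorem tstarvc_of_splitvc_abstract (mOV mOM mE mPV mPM mPMvc gOV gOM gE gPV gPM : ℝ)
    (hPV : 0 ≤ mPV) (hPM : 0 ≤ mPM) (hPMvc : 0 ≤ mPMvc) (hvc : mPMvc ≤ mPM) (hgPM : mPM = 0 → gPM = 0)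
    (hα : (mOV + mOM + mE) * (gPV + gPM) ≤ (mPV + mPM) * (gOV + gOM + gE))
    (hD2 : gPM * mOM ≤ gOM * mPM)
    (hS : mE * (mPMvc + mPV) * (gPV + gPM) - (mPV + mPM) * mPMvc * gE - (mPV + mPM) * mE * gPV < 0 →
      0 ≤ (mPV + mPM) * mPM * mPMvc * gOV - ((mOV + mOM) * mPMvc + mE * mPM) * mPM * gPV -
        (mOV * (mPV + mPM) * mPMvc - ((mOV + mOM) * mPMvc + mE * mPM) * mPV) * gPM) :
    0 ≤ (mPV + mPM) * (mPMvc * (gOV + gOM) - mE * gPV) - ((mOV + mOM) * mPMvc - mE * mPV) * (gPV + gPM) := by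
  set P := mPV + mPM with hP
  set O2 := mOV + mOM + mE with hO2
  have hP0 : 0 ≤ P := by rw [hP]; linarith
  set Xα := P * (gOV + gOM + gE) - O2 * (gPV + gPM) with hXα
  have hXα0 : 0 ≤ Xα := by rw [hXα]; linarith
  set K := mE * (mPMvc + mPV) * (gPV + gPM) - P * mPMvc * gE - P * mE * gPV with hK
  -- route (I): starvc = mPMvc·Xα + K
  have id1 : P * (mPMvc * (gOV + gOM) - mE * gPV) - ((mOV + mOM) * mPMvc - mE * mPV) * (gPV + gPM) = mPMvc * Xα + K := by
    rw [hXα, hK, hO2]; ring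
  by_cases hK0 : 0 ≤ K
  · rw [id1]
    have h1 : 0 ≤ mPMvc * Xα := mul_nonneg hPMvc hXα0
    linarith
  · rw [not_le] at hK0
    have hSPLIT := hS (by rw [hK] at hK0; exact hK0)
    set SPLIT := P * mPM * mPMvc * gOV - ((mOV + mOM) * mPMvc + mE * mPM) * mPM * gPV -
      (mOV * P * mPMvc - ((mOV + mOM) * mPMvc + mE * mPM) * mPV) * gPM with hSdef
    -- route (II): mPM·starvc = SPLIT + P·mPMvc·(mPM gOM − mOM gPM)
    have id2 : mPM * (P * (mPMvc * (gOV + gOM) - mE * gPV) - ((mOV + mOM) * mPMvc - mE * mPV) * (gPV + gPM)) =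
        SPLIT + P * mPMvc * (mPM * gOM - mOM * gPM) := by
      rw [hSdef, hP]; ring
    have hD2' : 0 ≤ P * mPMvc * (mPM * gOM - mOM * gPM) := mul_nonneg (mul_nonneg hP0 hPMvc) (by linarith)
    have hprod : 0 ≤ mPM * (P * (mPMvc * (gOV + gOM) - mE * gPV) - ((mOV + mOM) * mPMvc - mE * mPV) * (gPV + gPM)) := by
      rw [id2]; linarith
    rcases eq_or_lt_of_le hPM with hPM0 | hPMpos
    · -- mPM = 0: then mPMvc = 0, gPM = 0 and starvc = 0
      have hvc0 : mPMvc = 0 := le_antisymm (by rw [hPM0]; exact hvc) hPMvc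
      have hg0 : gPM = 0 := hgPM hPM0.symm
      have : P * (mPMvc * (gOV + gOM) - mE * gPV) - ((mOV + mOM) * mPMvc - mE * mPV) * (gPV + gPM) = 0 := by
        rw [hvc0, hg0, hP, ← hPM0]; ring
      rw [this]
    · by_contra hneg
      rw [not_le] at hneg
      have : mPM * (P * (mPMvc * (gOV + gOM) - mE * gPV) - ((mOV + mOM) * mPMvc - mE * mPV) * (gPV + gPM)) < 0 :=
        mul_neg_of_pos_of_neg hPMpos hneg
      linarith

end PocketCert

end Summit.CriticalPhenomena.PercolationContinuityZ3.Theorems
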